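import Summits.CriticalPhenomena.Ising3D.Control2DIsingSequences
import Mathlib.Tactic
import HarnessLib

/-!
# The 2D Ising witness, IV: positivity of the quasi-primary coefficients (barrier induction)
(cell `pub-ising3x`, seat controls-1 gen 37; NON-VACUITY of the 2D control's `A2D′` classes at
`Δ_σ = 1/8` by the Ising datum, step 4 — CONTROL-ONLY)

HONEST FRAMING: lottery ticket; floor = tightest certified 3D Ising CFT bounds; no exact-solution
claim without a proof. CONTROL-ONLY (`d = 2`); nothing numerical is asserted here.

The coefficients `A_j`, `B_j` of `Control2DIsingSequences` satisfy, in ratio form and with `h = h_{j+2}`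
the weight of the new term, `c_{j+2} = a(h) c_{j+1} - b(h) c_j` with
`a(h) = -M₀(h-2)/M₋(h) → 1/8`, `b(h) = M₊(h-4)/M₋(h) → 1/256` — a recursion with a NEGATIVE coefficient
whose characteristic equation has the double root `1/16` (the two solutions behave like
`16^{-h/2} h^{-5/4}` and `16^{-h/2} h^{-9/4}`), so positivity is not termwise obvious. It follows from a
BARRIER: with `ℓ(h) = (2h-7)/(32h)` one has, for every real `h ≥ 8`,

  `a(h) - b(h)/ℓ(h-2) ≥ ℓ(h)`    (`ising_barrier`: the difference is `N(h)/D(h)` with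
  `N(8+s) = 26820 + 111648 s + 77452 s² + 21640 s³ + 2720 s⁴ + 128 s⁵`),

hence `c_{j+1} ≥ ℓ(h_{j+1}) c_j > 0` propagates (`barrier_step`). The induction starts at `(A_2, A_3)` and
`(B_2, B_3)` (explicit values); `A_0, A_1, B_0 > 0` and `B_1 = 0` directly. Results: `isingA_pos`
(`A_j > 0`), `isingB_nonneg` (`B_j ≥ 0`, `= 0` only at `j = 1`), `isingB_pos_of_two_le`.
Finite algebra only (one polynomial inequality); pre-checked in exact arithmetic.

References: A. A. Belavin, A. M. Polyakov, A. B. Zamolodchikov, Nucl. Phys. B 241 (1984) 333, App. E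
[cite: BelavinPolyakovZamolodchikov1984, App. E]. Tree: `isingA`, `isingB`, `isingA_succ_succ`,
`isingB_succ_succ`, `isingMplus/Mzero/Mminus`.
-/

namespace Summit.CriticalPhenomena.Ising3D.Control2D

open Finset
open Literature.MathematicalPhysics.QuantumFieldTheory.ConformalBootstrap3D

/-! ### The barrier inequality -/

/-- The barrier `ℓ(h) = (2h-7)/(32h)` (a lower bound for `c_h/c_{h-2}`; the true ratio is
`(1/16)(1 - 5/(2h) + …)`). [folklore] -/
noncomputable def isingBarrier (h : ℝ) : ℝ := (2 * h - 7) / (32 * h)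

/-- `ℓ(h) > 0` for `h > 7/2`. [folklore] -/
theorem isingBarrier_pos {h : ℝ} (hh : 7 / 2 < h) : 0 < isingBarrier h := by
  unfold isingBarrier
  apply div_pos <;> linarith

/-- **The barrier inequality**: `-M₀(h-2)/M₋(h) - (M₊(h-4)/M₋(h))/ℓ(h-2) - ℓ(h) ≥ 0` for `h ≥ 8`
(as `N(h)/D(h)` with `N(8+s)` a polynomial with non-negative coefficients and `D(h) > 0`).
[folklore] -/
theorem ising_barrier {h : ℝ} (hh : 8 ≤ h) :
    isingBarrier h ≤ -isingMzero (h - 2) / isingMminus h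
      - (isingMplus (h - 4) / isingMminus h) / isingBarrier (h - 2) := by
  have h0 : 0 < h := by linarith
  have h1 : 0 < 2 * h - 1 := by linarith
  have h3 : 0 < 2 * h - 3 := by linarith
  have h5 : 0 < 2 * h - 5 := by linarith
  have h7 : 0 < 2 * h - 7 := by linarith
  have h11 : 0 < 2 * h - 11 := by linarith
  have hm2 : 0 < h - 2 := by linarith
  have key : -isingMzero (h - 2) / isingMminus h
      - (isingMplus (h - 4) / isingMminus h) / isingBarrier (h - 2) - isingBarrier h =
      (128 * h ^ 5 - 2400 * h ^ 4 + 16520 * h ^ 3 - 52788 * h ^ 2 + 78176 * h - 42300) /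
        (32 * h * (2 * h - 1) * (2 * h - 3) * (2 * h - 5) * (2 * h - 7) ^ 2 * (2 * h - 11)) := by
    unfold isingMzero isingMminus isingMplus isingBarrier
    have e1 : 2 * (h - 2) - 1 = 2 * h - 5 := by ring
    have e2 : 2 * (h - 2) + 1 = 2 * h - 3 := by ring
    have e3 : 2 * (h - 2) - 3 = 2 * h - 7 := by ring
    have e4 : 2 * (h - 2) - 5 = 2 * h - 9 := by ring
    have e5 : 2 * (h - 4) + 1 = 2 * h - 7 := by ring
    have e6 : 2 * (h - 4) + 3 = 2 * h - 5 := by ring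
    have e7 : 2 * (h - 2) - 7 = 2 * h - 11 := by ring
    have e8 : 32 * (h - 2) = 32 * h - 64 := by ring
    rw [e1, e2, e3, e4, e5, e6, e7, e8]
    have : 2 * h - 1 ≠ 0 := h1.ne'
    have : h * 2 - 1 ≠ 0 := by linarith
    have : 2 * h - 3 ≠ 0 := h3.ne'
    have : h * 2 - 3 ≠ 0 := by linarith
    have : 2 * h - 5 ≠ 0 := h5.ne'
    have : h * 2 - 5 ≠ 0 := by linarith
    have : 2 * h - 7 ≠ 0 := h7.ne'
    have : h * 2 - 7 ≠ 0 := by linarith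
    have : 2 * h - 11 ≠ 0 := h11.ne'
    have : h * 2 - 11 ≠ 0 := by linarith
    have : 32 * h - 64 ≠ 0 := by linarith
    have : h * 32 - 64 ≠ 0 := by linarith
    field_simp
    ring
  have hnum : 0 ≤ 128 * h ^ 5 - 2400 * h ^ 4 + 16520 * h ^ 3 - 52788 * h ^ 2 + 78176 * h - 42300 := by
    obtain ⟨s, hs, rfl⟩ : ∃ s : ℝ, 0 ≤ s ∧ h = 8 + s := ⟨h - 8, by linarith, by ring⟩
    have e : 128 * (8 + s) ^ 5 - 2400 * (8 + s) ^ 4 + 16520 * (8 + s) ^ 3 - 52788 * (8 + s) ^ 2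
        + 78176 * (8 + s) - 42300 =
        26820 + 111648 * s + 77452 * s ^ 2 + 21640 * s ^ 3 + 2720 * s ^ 4 + 128 * s ^ 5 := by ring
    rw [e]
    positivity
  have hden : 0 < 32 * h * (2 * h - 1) * (2 * h - 3) * (2 * h - 5) * (2 * h - 7) ^ 2 * (2 * h - 11) := by
    positivity
  have : 0 ≤ -isingMzero (h - 2) / isingMminus h
      - (isingMplus (h - 4) / isingMminus h) / isingBarrier (h - 2) - isingBarrier h := by
    rw [key]; exact div_nonneg hnum hden.le
  linarith

/-- **The barrier step.** If `c₂ = a c₁ - b c₀` with `b ≥ 0`, `c₀ > 0`, `ℓ₁ c₀ ≤ c₁`, `ℓ₁ > 0` and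
`ℓ₂ ≤ a - b/ℓ₁`, then `c₁ > 0` and `ℓ₂ c₁ ≤ c₂`. Elementary. [folklore] -/
theorem barrier_step {a b c₀ c₁ c₂ ℓ₁ ℓ₂ : ℝ} (hrec : c₂ = a * c₁ - b * c₀) (hb : 0 ≤ b) (hc₀ : 0 < c₀)
    (hl₁ : 0 < ℓ₁) (hstep : ℓ₁ * c₀ ≤ c₁) (hkey : ℓ₂ ≤ a - b / ℓ₁) : 0 < c₁ ∧ ℓ₂ * c₁ ≤ c₂ := by
  have hc₁ : 0 < c₁ := lt_of_lt_of_le (mul_pos hl₁ hc₀) hstep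
  refine ⟨hc₁, ?_⟩
  have h1 : c₀ ≤ c₁ / ℓ₁ := by rw [le_div_iff₀ hl₁]; linarith
  have h2 : b * c₀ ≤ b * (c₁ / ℓ₁) := mul_le_mul_of_nonneg_left h1 hb
  have h3 : ℓ₂ * c₁ ≤ (a - b / ℓ₁) * c₁ := mul_le_mul_of_nonneg_right hkey hc₁.le
  have h4 : (a - b / ℓ₁) * c₁ = a * c₁ - b * (c₁ / ℓ₁) := by ring
  linarith

/-! ### Positivity of `A` -/

/-- `M₊(h) ≥ 0` for `h ≥ 1`. [folklore] -/
theorem isingMplus_nonneg {h : ℝ} (hh : 1 ≤ h) : 0 ≤ isingMplus h := by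
  unfold isingMplus
  apply div_nonneg
  · have : 0 ≤ h - 1 := by linarith
    positivity
  · positivity

/-- The barrier induction for `A`: `A_j > 0` and `ℓ(2j+2) A_j ≤ A_{j+1}` for all `j ≥ 2`. [folklore] -/
theorem isingA_barrier : ∀ n : ℕ, 0 < isingA (n + 2) ∧
    isingBarrier (2 * ((n : ℝ) + 2) + 2) * isingA (n + 2) ≤ isingA (n + 3) := by
  intro n
  induction n with
  | zero =>
    rw [isingA_two, isingA_three]
    norm_num [isingBarrier]
  | succ n ih =>
    obtain ⟨hpos, hstep⟩ := ih
    have hrec := isingA_succ_succ (n + 2)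
    rw [show n + 2 + 2 = n + 1 + 3 from rfl, show n + 2 + 1 = n + 3 from rfl] at hrec
    have hh : (8 : ℝ) ≤ 2 * ((n : ℝ) + 4) := by
      have : (0 : ℝ) ≤ n := Nat.cast_nonneg n
      linarith
    have K := ising_barrier hh
    have hD : isingIdD (n + 4) = isingMminus (2 * ((n : ℝ) + 4)) := by
      simp [isingIdD]
    have hZ : isingIdZ (n + 3) = isingMzero (2 * ((n : ℝ) + 4) - 2) := by
      simp only [isingIdZ]; push_cast; ring_nf
    have hU : isingIdU (n + 2) = isingMplus (2 * ((n : ℝ) + 4) - 4) := by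
      simp only [isingIdU]; push_cast; ring_nf
    have hl1 : isingBarrier (2 * ((n : ℝ) + 2) + 2) = isingBarrier (2 * ((n : ℝ) + 4) - 2) := by ring_nf
    have hb : 0 ≤ isingIdU (n + 2) / isingIdD (n + 4) := by
      apply div_nonneg
      · rw [hU]; apply isingMplus_nonneg; have : (0 : ℝ) ≤ n := Nat.cast_nonneg n; linarith
      · exact (isingIdD_pos (by omega)).le
    have hl₁ : 0 < isingBarrier (2 * ((n : ℝ) + 2) + 2) := by
      apply isingBarrier_pos; have : (0 : ℝ) ≤ n := Nat.cast_nonneg n; linarith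
    have R := barrier_step (ℓ₂ := isingBarrier (2 * ((n : ℝ) + 4))) hrec hb hpos hl₁ hstep
      (by rw [hZ, hU, hD, hl1]; exact K)
    refine ⟨R.1, ?_⟩
    rw [show n + 1 + 3 = n + 4 from rfl]
    have e : isingBarrier (2 * (((n + 1 : ℕ) : ℝ) + 2) + 2) = isingBarrier (2 * ((n : ℝ) + 4)) := by
      push_cast; ring_nf
    rw [e]
    exact R.2

/-- **Every vacuum-module quasi-primary coefficient of `⟨σσσσ⟩` is positive**: `A_j > 0`.
[cite: BelavinPolyakovZamolodchikov1984, App. E] -/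
theorem isingA_pos (j : ℕ) : 0 < isingA j := by
  match j with
  | 0 => rw [isingA_zero]; norm_num
  | 1 => rw [isingA_one]; norm_num
  | n + 2 => exact (isingA_barrier n).1

/-- `A_j ≥ 0`. [folklore] -/
theorem isingA_nonneg (j : ℕ) : 0 ≤ isingA j := (isingA_pos j).le

/-! ### Positivity of `B` -/

/-- The barrier induction for `B`: `B_j > 0` and `ℓ(2j+5/2) B_j ≤ B_{j+1}` for all `j ≥ 2`. [folklore] -/
theorem isingB_barrier : ∀ n : ℕ, 0 < isingB (n + 2) ∧
    isingBarrier (1 / 2 + 2 * ((n : ℝ) + 2) + 2) * isingB (n + 2) ≤ isingB (n + 3) := by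
  intro n
  induction n with
  | zero =>
    rw [isingB_two, isingB_three]
    norm_num [isingBarrier]
  | succ n ih =>
    obtain ⟨hpos, hstep⟩ := ih
    have hrec := isingB_succ_succ (n + 2)
    rw [show n + 2 + 2 = n + 1 + 3 from rfl, show n + 2 + 1 = n + 3 from rfl] at hrec
    have hh : (8 : ℝ) ≤ 1 / 2 + 2 * ((n : ℝ) + 4) := by
      have : (0 : ℝ) ≤ n := Nat.cast_nonneg n
      linarith
    have K := ising_barrier hh
    have hn2 : (n + 2 : ℕ) ≠ 0 := by omega
    have hn3 : (n + 3 : ℕ) ≠ 0 := by omega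
    have hD : isingEpD (n + 4) = isingMminus (1 / 2 + 2 * ((n : ℝ) + 4)) := by
      simp only [isingEpD]; push_cast; ring_nf
    have hZ : isingEpZ (n + 3) = isingMzero (1 / 2 + 2 * ((n : ℝ) + 4) - 2) := by
      simp only [isingEpZ, if_neg hn3]; push_cast; ring_nf
    have hU : isingEpU (n + 2) = isingMplus (1 / 2 + 2 * ((n : ℝ) + 4) - 4) := by
      simp only [isingEpU, if_neg hn2]; push_cast; ring_nf
    have hl1 : isingBarrier (1 / 2 + 2 * ((n : ℝ) + 2) + 2) = isingBarrier (1 / 2 + 2 * ((n : ℝ) + 4) - 2) := by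
      ring_nf
    have hb : 0 ≤ isingEpU (n + 2) / isingEpD (n + 4) := by
      apply div_nonneg
      · rw [hU]; apply isingMplus_nonneg; have : (0 : ℝ) ≤ n := Nat.cast_nonneg n; linarith
      · exact (isingEpD_pos (by omega)).le
    have hl₁ : 0 < isingBarrier (1 / 2 + 2 * ((n : ℝ) + 2) + 2) := by
      apply isingBarrier_pos; have : (0 : ℝ) ≤ n := Nat.cast_nonneg n; linarith
    have R := barrier_step (ℓ₂ := isingBarrier (1 / 2 + 2 * ((n : ℝ) + 4))) hrec hb hpos hl₁ hstep
      (by rw [hZ, hU, hD, hl1]; exact K)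
    refine ⟨R.1, ?_⟩
    rw [show n + 1 + 3 = n + 4 from rfl]
    have e : isingBarrier (1 / 2 + 2 * (((n + 1 : ℕ) : ℝ) + 2) + 2) = isingBarrier (1 / 2 + 2 * ((n : ℝ) + 4)) := by
      push_cast; ring_nf
    rw [e]
    exact R.2

/-- `B_j > 0` for `j ≥ 2` (and `B_0 = 1/2 > 0`, `B_1 = 0`). [cite: BelavinPolyakovZamolodchikov1984, App. E] -/
theorem isingB_pos_of_two_le {j : ℕ} (hj : 2 ≤ j) : 0 < isingB j := by
  obtain ⟨n, rfl⟩ := Nat.exists_eq_add_of_le' hj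
  exact (isingB_barrier n).1

/-- **Every `ε`-module quasi-primary coefficient of `⟨σσσσ⟩` is non-negative**: `B_j ≥ 0`.
[cite: BelavinPolyakovZamolodchikov1984, App. E] -/
theorem isingB_nonneg (j : ℕ) : 0 ≤ isingB j := by
  match j with
  | 0 => rw [isingB_zero]; norm_num
  | 1 => rw [isingB_one]
  | n + 2 => exact (isingB_barrier n).1.le

end Summit.CriticalPhenomena.Ising3D.Control2D
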